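import Mathlib
import HarnessLib
import Literature.Probability.ImportanceSampling.ChatterjeeDiaconis
import Summits.Ventures.LatticeQCDFlow.Exactness.NCMCGeneralSpaceRelativeEntropy
import Summits.Ventures.LatticeQCDFlow.Scoring.BlockFactorSecondMoments

/-!
# NCMCGeneralSpaceSampleSizeCorrelated — the SUFFICIENCY half of the importance-sampling
# sample-size law for CORRELATED draws on a general state space: identical one-draw marginals plus
# a variance-inflation factor `C` give `E|I_N(f) − I(f)| ≤ ‖f‖_{L²(ν)}·(√C·e^{−t/4} + 2√(ν{L + t/2 < log ρ}))`
# for `N ≥ e^{L + t}`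

HONEST FRAMING: exact (Metropolis-corrected) sampling algorithms for lattice gauge theory;
figures of merit are autocorrelation/cost numbers at stated couplings and volumes; no
continuum-physics claim.

Venture `LatticeQCDFlow` (cell pub-lqcd); FANOUT row 19 (`su2-snf`, GEN-8), next to row 13's
`Exactness/NCMCGeneralSpace*` series.  OUR WORK (general measure theory, elementary); nothing is
cited as a fact.  The Literature's Chatterjee–Diaconis theorem
(`Literature/Probability/ImportanceSampling/ChatterjeeDiaconis`, Ann. Appl. Probab. 28 (2018)
Thm 1.1, PROVED there) is stated for i.i.d. draws.  Its SUFFICIENCY half (§4 of the paper: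
truncate `f` at `ρ ≤ a = e^{L + t/2}`, two Cauchy–Schwarz tail terms, one variance bound
`Var(I_N h) = Var_μ(hρ)/N`) uses independence ONLY in the variance bound.  This file proves that
half for ANY joint law `Q` of the `N` draws whose one-draw marginals are the proposal `μ` and
which satisfies a VARIANCE-INFLATION hypothesis
`Var_Q(Σᵢ g(xᵢ)) ≤ C·N·Var_μ(g)` for every `g ∈ L²(μ)` (`C = 1` for independent or pairwise
uncorrelated draws; for records launched from a stationary prior chain `C` is an integrated
autocorrelation factor of the chain of starts — row 8's `Scoring/RestartChainAutocorrelation`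
vocabulary: the lag-`k ≥ 1` autocovariance of a record observable is the prior chain's
autocovariance of its conditional mean given the start).  The conclusion is the printed one with
`e^{−t/4}` inflated by `√C`, i.e. with `N` replaced by the effective number of draws `N/C`.
Companions: `Exactness/NCMCGeneralSpaceSampleSizeMarginals` (the NECESSITY half needs only the
marginals, no variance input), `Exactness/NCMCGeneralSpaceSampleSize` (independent records, the
Literature theorem verbatim), and the finite path-space version
`Scaling/SampleSizeSufficientCorrelated`.

* `integral_abs_mul_indicator_le` — Cauchy–Schwarz against an indicator, `∫_A |f| dν ≤ ‖f‖₂ √ν(A)`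
  (the Literature file's helper is private; `E|X| ≤ √(E X²)` is row 16's
  `Scoring.integral_abs_le_sqrt_integral_sq_of_memLp`, imported);
* `memLp_two_truncWeight`, `abs_truncWeight_le` — the truncated reweighted integrand
  `h·ρ = f·1{ρ ≤ a}·ρ` is in `L²(μ)` for `f ∈ L²(ν)` (`(hρ)² ≤ ρ·a f²`), and bounded by `B·a` for
  `|f| ≤ B`: the two facts that put `hρ` in the class where a user's variance-inflation factor holds;
* **`sampleSize_sufficient_threshold_of_varianceBound`** — probability measures `ν ≪ μ`,
  `ρ = dν/dμ`, measurable `f ∈ L²(ν)`, a probability measure `Q` on `Fin N → 𝓧` (`N ≥ 1`) with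
  `Q ∘ (x ↦ xᵢ)⁻¹ = μ` for every `i`; a threshold `a > 0` and `C ≥ 0` with the ONE variance input
  `Var_Q(Σᵢ (hρ)(xᵢ)) ≤ C·N·Var_μ(hρ)`:
  `∫ |I_N(f) − ∫ f dν| dQ ≤ ‖f‖₂ · (√(C·a/N) + 2 √(ν{a < ρ}))`.
The CLASS forms (variance inflation on all of `L²(μ)`, or on all bounded measurable `g`) with the
threshold `a = e^{L + t/2}` converted to the sample size `N ≥ e^{L + t}` are the companion
`Exactness/NCMCGeneralSpaceSampleSizeVarianceInflation`; the docking to row 13's Crooks pairs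
(forward records with `P_F` marginals, exponent `E_{P_R}[ΔF − W]`, the `e^t/ESS_F` form) is
`Exactness/NCMCGeneralSpaceSampleSizeCorrelatedCrooks`.

NOT CLAIMED: any value of `C` for a concrete restart chain (an INPUT; a Doeblin / spectral-gap
constant of the PRIOR chain bounds it — separate file); non-stationary starts; the necessity half
(see `…SampleSizeMarginals`, which needs no variance input).
-/

namespace Summit.Ventures.LatticeQCDFlow.Exactness.GeneralNCMC

open MeasureTheory ProbabilityTheory Set Filter
open scoped ENNReal
open Literature.Probability.ImportanceSampling (isEstimate)

/-! ## §1 A Cauchy–Schwarz step -/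

section CS

variable {𝓧 : Type*} [MeasurableSpace 𝓧]

/-- Cauchy–Schwarz against an indicator: `∫ |f|·1_A dν ≤ ‖f‖₂ √ν(A)`. -/
theorem integral_abs_mul_indicator_le {ν : Measure 𝓧} [IsProbabilityMeasure ν] {f : 𝓧 → ℝ}
    (hf : MemLp f 2 ν) {A : Set 𝓧} (hA : MeasurableSet A) :
    ∫ y, |f y| * A.indicator (fun _ => (1 : ℝ)) y ∂ν ≤
      Real.sqrt (∫ y, f y ^ 2 ∂ν) * Real.sqrt (ν A).toReal := by
  have hind : MemLp (A.indicator fun _ => (1 : ℝ)) (ENNReal.ofReal 2) ν := by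
    simpa using ((memLp_const (1 : ℝ)).indicator hA : MemLp (A.indicator fun _ => (1:ℝ)) 2 ν)
  have h1 : MemLp (fun y => |f y|) (ENNReal.ofReal 2) ν := by
    rw [show ENNReal.ofReal 2 = 2 by simp]
    exact hf.abs
  have h := integral_mul_le_Lp_mul_Lq_of_nonneg (μ := ν) Real.HolderConjugate.two_two
    (f := fun y => |f y|) (g := A.indicator fun _ => (1 : ℝ))
    (ae_of_all _ (fun y => abs_nonneg _))
    (ae_of_all _ (fun y => Set.indicator_nonneg (fun _ _ => zero_le_one) y)) h1 hind
  have hsq : ∀ y, (A.indicator (fun _ => (1 : ℝ)) y) ^ (2 : ℝ) = A.indicator (fun _ => (1 : ℝ)) y := by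
    intro y
    by_cases hy : y ∈ A <;> simp [hy]
  have habs : ∀ y, |f y| ^ (2 : ℝ) = f y ^ 2 := fun y => by rw [Real.rpow_two, sq_abs]
  have hint : ∫ y, A.indicator (fun _ => (1 : ℝ)) y ∂ν = (ν A).toReal := by
    rw [integral_indicator hA, setIntegral_const, smul_eq_mul, mul_one, measureReal_def]
  simp only [hsq, habs, hint] at h
  rw [Real.sqrt_eq_rpow, Real.sqrt_eq_rpow]
  exact h

end CS

/-! ## §2 Importance sampling: sufficiency from identical marginals + variance inflation -/

section General

variable {𝓧 : Type*} [MeasurableSpace 𝓧]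

/-- The truncated reweighted integrand `h·ρ = f·1{ρ ≤ a}·ρ` is in `L²(μ)` when `f ∈ L²(ν)`:
`(hρ)² ≤ ρ·(a f²)` pointwise and `∫ ρ·(a f²) dμ = a‖f‖²_{L²(ν)}`. -/
theorem memLp_two_truncWeight (μ ν : Measure 𝓧) [IsProbabilityMeasure μ] [IsProbabilityMeasure ν]
    (hνμ : ν ≪ μ) {f : 𝓧 → ℝ} (hf : Measurable f) (hf2 : MemLp f 2 ν) {a : ℝ} (ha : 0 ≤ a) :
    MemLp (fun y => {y | (ν.rnDeriv μ y).toReal ≤ a}.indicator f y * (ν.rnDeriv μ y).toReal)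
      2 μ := by
  set ρ : 𝓧 → ℝ := fun y => (ν.rnDeriv μ y).toReal with hρ
  have hρm : Measurable ρ := (Measure.measurable_rnDeriv ν μ).ennreal_toReal
  have hρ0 : ∀ y, 0 ≤ ρ y := fun y => ENNReal.toReal_nonneg
  have hhm : Measurable ({y | ρ y ≤ a}.indicator f) :=
    hf.indicator (measurableSet_le hρm measurable_const)
  have hsq : ∀ y, ({y | ρ y ≤ a}.indicator f y * ρ y) ^ 2 ≤ ρ y * (a * f y ^ 2) := by
    intro y
    by_cases hy : ρ y ≤ a
    · have h1 : y ∈ {y | ρ y ≤ a} := hy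
      rw [Set.indicator_of_mem h1]
      calc (f y * ρ y) ^ 2 = ρ y * (ρ y * f y ^ 2) := by ring
        _ ≤ ρ y * (a * f y ^ 2) := by
            apply mul_le_mul_of_nonneg_left _ (hρ0 y)
            exact mul_le_mul_of_nonneg_right hy (sq_nonneg _)
    · have h1 : y ∉ {y | ρ y ≤ a} := hy
      rw [Set.indicator_of_notMem h1, zero_mul]
      have : (0:ℝ) ^ 2 = 0 := by norm_num
      rw [this]
      exact mul_nonneg (hρ0 y) (mul_nonneg ha (sq_nonneg _))
  have hmeas2 : AEStronglyMeasurable (fun y => {y | ρ y ≤ a}.indicator f y * ρ y) μ :=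
    (hhm.mul hρm).aestronglyMeasurable
  rw [memLp_two_iff_integrable_sq hmeas2]
  have hdom : Integrable (fun y => ρ y * (a * f y ^ 2)) μ :=
    (integrable_toReal_rnDeriv_mul_iff hνμ).mpr (hf2.integrable_sq.const_mul a)
  refine hdom.mono' ((hhm.mul hρm).pow_const 2).aestronglyMeasurable (ae_of_all _ fun y => ?_)
  rw [Real.norm_eq_abs, abs_of_nonneg (sq_nonneg _)]
  exact hsq y

/-- The truncated reweighted integrand of a BOUNDED `f` is bounded: `|f| ≤ B`, `a ≥ 0` ⇒
`|f·1{ρ ≤ a}·ρ| ≤ B·a`. -/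
theorem abs_truncWeight_le (μ ν : Measure 𝓧) {f : 𝓧 → ℝ} {B : ℝ} (hB : ∀ y, |f y| ≤ B)
    {a : ℝ} (ha : 0 ≤ a) (y : 𝓧) :
    |{y | (ν.rnDeriv μ y).toReal ≤ a}.indicator f y * (ν.rnDeriv μ y).toReal| ≤ B * a := by
  have hB0 : 0 ≤ B := le_trans (abs_nonneg _) (hB y)
  by_cases hy : (ν.rnDeriv μ y).toReal ≤ a
  · have h1 : y ∈ {y | (ν.rnDeriv μ y).toReal ≤ a} := hy
    rw [Set.indicator_of_mem h1, abs_mul, abs_of_nonneg ENNReal.toReal_nonneg]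
    exact mul_le_mul (hB y) hy ENNReal.toReal_nonneg hB0
  · have h1 : y ∉ {y | (ν.rnDeriv μ y).toReal ≤ a} := hy
    rw [Set.indicator_of_notMem h1, zero_mul, abs_zero]
    exact mul_nonneg hB0 ha

/-- **IMPORTANCE-SAMPLING SAMPLE SIZE, SUFFICIENCY, CORRELATED DRAWS — threshold form, with the
ONE variance input the proof uses.**  Probability measures `ν ≪ μ` on `𝓧`, `ρ = dν/dμ` (read in
`ℝ`), a measurable `f ∈ L²(ν)`; a probability measure `Q` on `Fin N → 𝓧`, `N ≥ 1`, all of whose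
one-draw marginals are `μ`; a threshold `a > 0` and a constant `C ≥ 0` such that the SUM of the
truncated reweighted integrand `h·ρ`, `h = f·1{ρ ≤ a}`, over the `N` draws has
`Var_Q(Σᵢ (hρ)(xᵢ)) ≤ C·N·Var_μ(hρ)` (`C = 1` for independent draws: `variance_sum_pi`).  Then
`∫ |I_N(f)(x) − ∫ f dν| dQ(x) ≤ ‖f‖_{L²(ν)} · (√(C·a/N) + 2·√(ν{a < ρ}))`
(`I_N(f)(x) = (1/N)Σᵢ f(xᵢ)ρ(xᵢ)`, the Literature's `isEstimate`).  The class forms (every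
`g ∈ L²(μ)`; every bounded measurable `g`) follow by `memLp_two_truncWeight` /
`abs_truncWeight_le`. -/
theorem sampleSize_sufficient_threshold_of_varianceBound (μ ν : Measure 𝓧)
    [IsProbabilityMeasure μ] [IsProbabilityMeasure ν] (hνμ : ν ≪ μ)
    {f : 𝓧 → ℝ} (hf : Measurable f) (hf2 : MemLp f 2 ν)
    {N : ℕ} (hN0 : N ≠ 0) (Q : Measure (Fin N → 𝓧)) [IsProbabilityMeasure Q]
    (hmarg : ∀ i : Fin N, Q.map (fun x => x i) = μ)
    {C : ℝ} (hC : 0 ≤ C) {a : ℝ} (ha : 0 < a)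
    (hvar : Var[fun x : Fin N → 𝓧 => ∑ i,
        {y | (ν.rnDeriv μ y).toReal ≤ a}.indicator f (x i) * (ν.rnDeriv μ (x i)).toReal; Q]
      ≤ C * N * Var[fun y => {y | (ν.rnDeriv μ y).toReal ≤ a}.indicator f y * (ν.rnDeriv μ y).toReal; μ]) :
    ∫ x, |isEstimate μ ν f N x - ∫ y, f y ∂ν| ∂Q ≤
      Real.sqrt (∫ y, f y ^ 2 ∂ν) *
        (Real.sqrt (C * a / N) + 2 * Real.sqrt (ν {y | a < (ν.rnDeriv μ y).toReal}).toReal) := by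
  -- the density and the coordinate maps
  set ρ : 𝓧 → ℝ := fun y => (ν.rnDeriv μ y).toReal with hρ
  have hρm : Measurable ρ := (Measure.measurable_rnDeriv ν μ).ennreal_toReal
  have hρ0 : ∀ y, 0 ≤ ρ y := fun y => ENNReal.toReal_nonneg
  have hmp : ∀ i : Fin N, MeasurePreserving (fun x : Fin N → 𝓧 => x i) Q μ :=
    fun i => ⟨measurable_pi_apply i, hmarg i⟩
  have integral_eval : ∀ (i : Fin N) {g : 𝓧 → ℝ}, AEStronglyMeasurable g μ →
      ∫ x, g (x i) ∂Q = ∫ y, g y ∂μ := by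
    intro i g hg
    have h1 : ∫ y, g y ∂(Q.map fun x => x i) = ∫ x, g (x i) ∂Q := by
      apply integral_map (measurable_pi_apply i).aemeasurable
      rw [(hmp i).map_eq]
      exact hg
    rw [← h1, (hmp i).map_eq]
  have integral_dens_mul : ∀ g : 𝓧 → ℝ, ∫ y, ρ y * g y ∂μ = ∫ y, g y ∂ν :=
    fun g => integral_toReal_rnDeriv_mul hνμ
  have integrable_dens_mul_iff : ∀ {g : 𝓧 → ℝ},
      Integrable (fun y => ρ y * g y) μ ↔ Integrable g ν :=
    fun {g} => integrable_toReal_rnDeriv_mul_iff hνμ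
  set A : Set 𝓧 := {y | a < ρ y} with hA
  have hAm : MeasurableSet A := measurableSet_lt measurable_const hρm
  set F : ℝ := ∫ y, f y ^ 2 ∂ν with hF
  -- the truncation `h = f · 1{ρ ≤ a}`
  set h : 𝓧 → ℝ := {y | ρ y ≤ a}.indicator f with hh
  have hhm : Measurable h := hf.indicator (measurableSet_le hρm measurable_const)
  have hN' : (N : ℝ) ≠ 0 := by exact_mod_cast hN0
  have hNpos : (0 : ℝ) < N := by exact_mod_cast Nat.pos_of_ne_zero hN0
  have habs : ∀ y, |f y - h y| = |f y| * A.indicator (fun _ => (1:ℝ)) y := by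
    intro y
    by_cases hy : ρ y ≤ a
    · have h1 : y ∈ {y | ρ y ≤ a} := hy
      have h2 : y ∉ A := by rw [hA]; simp only [Set.mem_setOf_eq, not_lt]; exact hy
      rw [hh, Set.indicator_of_mem h1, Set.indicator_of_notMem h2, sub_self, abs_zero, mul_zero]
    · have h1 : y ∉ {y | ρ y ≤ a} := hy
      have h2 : y ∈ A := by rw [hA]; simp only [Set.mem_setOf_eq]; exact lt_of_not_ge hy
      rw [hh, Set.indicator_of_notMem h1, Set.indicator_of_mem h2, sub_zero, mul_one]
  have hsq : ∀ y, (h y * ρ y) ^ 2 ≤ ρ y * (a * f y ^ 2) := by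
    intro y
    by_cases hy : ρ y ≤ a
    · have h1 : y ∈ {y | ρ y ≤ a} := hy
      rw [hh, Set.indicator_of_mem h1]
      calc (f y * ρ y) ^ 2 = ρ y * (ρ y * f y ^ 2) := by ring
        _ ≤ ρ y * (a * f y ^ 2) := by
            apply mul_le_mul_of_nonneg_left _ (hρ0 y)
            exact mul_le_mul_of_nonneg_right hy (sq_nonneg _)
    · have h1 : y ∉ {y | ρ y ≤ a} := hy
      rw [hh, Set.indicator_of_notMem h1, zero_mul]
      have : (0:ℝ) ^ 2 = 0 := by norm_num
      rw [this]
      exact mul_nonneg (hρ0 y) (mul_nonneg ha.le (sq_nonneg _))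
  -- integrability facts on 𝓧
  have hfi : Integrable f ν := hf2.integrable one_le_two
  have hhi : Integrable h ν := hfi.indicator (measurableSet_le hρm measurable_const)
  have hfd : Integrable (fun y => f y * ρ y) μ := by
    have := integrable_dens_mul_iff.mpr hfi
    exact this.congr (ae_of_all _ fun y => mul_comm _ _)
  have hhd : Integrable (fun y => h y * ρ y) μ := by
    have := integrable_dens_mul_iff.mpr hhi
    exact this.congr (ae_of_all _ fun y => mul_comm _ _)
  have hgi : Integrable (fun y => |f y| * A.indicator (fun _ => (1:ℝ)) y) ν := by
    have : Integrable (fun y => |f y - h y|) ν := (hfi.sub hhi).abs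
    exact this.congr (ae_of_all _ fun y => habs y)
  have hgd : Integrable (fun y => |f y| * A.indicator (fun _ => (1:ℝ)) y * ρ y) μ := by
    have := integrable_dens_mul_iff.mpr hgi
    exact this.congr (ae_of_all _ fun y => by simp only; ring)
  -- the tail term  T := ∫ |f| 1_A dν ≤ √F √ν(A)
  set T : ℝ := ∫ y, |f y| * A.indicator (fun _ => (1:ℝ)) y ∂ν with hT
  have hT_le : T ≤ Real.sqrt F * Real.sqrt (ν A).toReal := integral_abs_mul_indicator_le hf2 hAm
  have hgd_int : ∫ y, |f y| * A.indicator (fun _ => (1:ℝ)) y * ρ y ∂μ = T := by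
    rw [hT, ← integral_dens_mul]
    exact integral_congr_ae (ae_of_all _ fun y => by simp only; ring)
  -- L² fact for h·ρ under μ and the variance bound  Var_μ(hρ) ≤ a F
  have hhd2 : MemLp (fun y => h y * ρ y) 2 μ := memLp_two_truncWeight μ ν hνμ hf hf2 ha.le
  have hvar_le : Var[fun y => h y * ρ y; μ] ≤ a * F := by
    refine le_trans (variance_le_expectation_sq (hhm.mul hρm).aestronglyMeasurable) ?_
    calc ∫ y, ((fun y => h y * ρ y) ^ 2) y ∂μ
        ≤ ∫ y, ρ y * (a * f y ^ 2) ∂μ := by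
          apply integral_mono_of_nonneg (ae_of_all _ fun y => sq_nonneg _)
            (integrable_dens_mul_iff.mpr (hf2.integrable_sq.const_mul a))
            (ae_of_all _ fun y => hsq y)
      _ = a * F := by rw [integral_dens_mul, integral_const_mul]
  -- the sum S = Σ_i h(x i) ρ(x i) under Q: mean N·∫h dν, variance ≤ C N a F (the hypothesis)
  have hY2 : ∀ i : Fin N, MemLp (fun x : Fin N → 𝓧 => h (x i) * ρ (x i)) 2 Q := fun i =>
    hhd2.comp_measurePreserving (hmp i)
  have hYint : ∀ i : Fin N, ∫ x, h (x i) * ρ (x i) ∂Q = ∫ y, h y ∂ν := by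
    intro i
    rw [integral_eval i (g := fun y => h y * ρ y) hhd.aestronglyMeasurable, ← integral_dens_mul h]
    exact integral_congr_ae (ae_of_all _ fun y => mul_comm _ _)
  set S : (Fin N → 𝓧) → ℝ := fun x => ∑ i, h (x i) * ρ (x i) with hS
  have hS2 : MemLp S 2 Q := by
    have := memLp_finsetSum Finset.univ (fun i _ => hY2 i)
    simpa only [hS] using this
  have hSvar : Var[S; Q] ≤ C * N * (a * F) :=
    le_trans hvar (mul_le_mul_of_nonneg_left hvar_le (by positivity))
  have hSint : ∫ x, S x ∂Q = N * ∫ y, h y ∂ν := by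
    simp only [hS]
    rw [integral_finsetSum _ (fun i _ => (hY2 i).integrable one_le_two)]
    simp only [hYint, Finset.sum_const, Finset.card_univ, Fintype.card_fin, nsmul_eq_mul]
  -- I_N h = S / N  and  E|I_N h − I h| ≤ √(C a/N) √F
  have hInh : ∀ x, isEstimate μ ν h N x = (1 / (N:ℝ)) * S x := fun x => rfl
  have hmid : ∫ x, |isEstimate μ ν h N x - ∫ y, h y ∂ν| ∂Q
      ≤ Real.sqrt (C * a / N) * Real.sqrt F := by
    have hcen : MemLp (fun x => S x - ∫ x, S x ∂Q) 2 Q := hS2.sub (memLp_const _)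
    have h1 : ∫ x, |S x - ∫ x, S x ∂Q| ∂Q ≤ Real.sqrt (∫ x, (S x - ∫ x, S x ∂Q) ^ 2 ∂Q) :=
      Scoring.integral_abs_le_sqrt_integral_sq_of_memLp hcen
    have h2 : ∫ x, (S x - ∫ x, S x ∂Q) ^ 2 ∂Q = Var[S; Q] :=
      (variance_eq_integral hS2.aemeasurable).symm
    have heq : ∀ x, |isEstimate μ ν h N x - ∫ y, h y ∂ν| =
        (1 / (N:ℝ)) * |S x - ∫ x, S x ∂Q| := by
      intro x
      have hre : (1 / (N:ℝ)) * (S x - N * ∫ y, h y ∂ν) = (1 / (N:ℝ)) * S x - ∫ y, h y ∂ν := by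
        rw [mul_sub, ← mul_assoc, one_div_mul_cancel hN', one_mul]
      rw [hInh, hSint, ← hre, abs_mul, abs_of_pos (by positivity : (0:ℝ) < 1 / N)]
    simp_rw [heq]
    rw [integral_const_mul]
    have hCNaF : (0:ℝ) ≤ C * N * (a * F) := by positivity
    calc 1 / (N:ℝ) * ∫ x, |S x - ∫ x, S x ∂Q| ∂Q
        ≤ 1 / (N:ℝ) * Real.sqrt (Var[S; Q]) := by
          apply mul_le_mul_of_nonneg_left _ (by positivity)
          rw [← h2]; exact h1
      _ ≤ 1 / (N:ℝ) * Real.sqrt (C * N * (a * F)) := by gcongr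
      _ = Real.sqrt (C * a / N) * Real.sqrt F := by
          rw [← Real.sqrt_mul (show (0:ℝ) ≤ C * a / N by positivity) F,
            show C * a / N * F = (1 / (N:ℝ)) ^ 2 * (C * N * (a * F)) by field_simp,
            Real.sqrt_mul (by positivity : (0:ℝ) ≤ (1 / (N:ℝ)) ^ 2), Real.sqrt_sq (by positivity)]
  -- integrability of the estimates under Q
  have hI : ∀ g : 𝓧 → ℝ, Integrable (fun y => g y * ρ y) μ →
      Integrable (isEstimate μ ν g N) Q := by
    intro g hg
    unfold isEstimate
    apply Integrable.const_mul
    apply integrable_finsetSum _ (fun i _ => ?_)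
    exact (hmp i).integrable_comp_of_integrable hg
  -- first term: E|I_N f − I_N h| ≤ T
  have hfirst : ∫ x, |isEstimate μ ν f N x - isEstimate μ ν h N x| ∂Q ≤ T := by
    have hpt : ∀ x, |isEstimate μ ν f N x - isEstimate μ ν h N x| ≤
        (1 / (N:ℝ)) * ∑ i, |f (x i)| * A.indicator (fun _ => (1:ℝ)) (x i) * ρ (x i) := by
      intro x
      simp only [isEstimate]
      rw [← mul_sub, ← Finset.sum_sub_distrib, abs_mul,
        abs_of_pos (by positivity : (0:ℝ) < 1 / N)]
      apply mul_le_mul_of_nonneg_left _ (by positivity)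
      refine le_trans (Finset.abs_sum_le_sum_abs _ _) (Finset.sum_le_sum fun i _ => ?_)
      rw [← sub_mul, abs_mul, abs_of_nonneg ENNReal.toReal_nonneg, habs (x i)]
    have hGi : ∀ i : Fin N, Integrable
        (fun x : Fin N → 𝓧 => |f (x i)| * A.indicator (fun _ => (1:ℝ)) (x i) * ρ (x i)) Q :=
      fun i => (hmp i).integrable_comp_of_integrable hgd
    have hGint : ∀ i : Fin N,
        ∫ x, |f (x i)| * A.indicator (fun _ => (1:ℝ)) (x i) * ρ (x i) ∂Q = T := by
      intro i
      rw [integral_eval i (g := fun y => |f y| * A.indicator (fun _ => (1:ℝ)) y * ρ y)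
        hgd.aestronglyMeasurable, hgd_int]
    calc ∫ x, |isEstimate μ ν f N x - isEstimate μ ν h N x| ∂Q
        ≤ ∫ x, (1 / (N:ℝ)) * ∑ i, |f (x i)| * A.indicator (fun _ => (1:ℝ)) (x i) * ρ (x i) ∂Q :=
          integral_mono_of_nonneg (ae_of_all _ fun _ => abs_nonneg _)
            ((integrable_finsetSum _ (fun i _ => hGi i)).const_mul _) (ae_of_all _ hpt)
      _ = T := by
          rw [integral_const_mul, integral_finsetSum _ (fun i _ => hGi i)]
          simp only [hGint, Finset.sum_const, Finset.card_univ, Fintype.card_fin, nsmul_eq_mul]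
          rw [← mul_assoc, one_div_mul_cancel hN', one_mul]
  -- last term: |I h − I f| ≤ T
  have hlast : |(∫ y, h y ∂ν) - ∫ y, f y ∂ν| ≤ T := by
    rw [← integral_sub hhi hfi]
    refine le_trans abs_integral_le_integral_abs (le_of_eq ?_)
    exact integral_congr_ae (ae_of_all _ fun y => by simp only; rw [abs_sub_comm, habs])
  -- assembly
  have h3 : ∀ x, |isEstimate μ ν f N x - ∫ y, f y ∂ν| ≤
      |isEstimate μ ν f N x - isEstimate μ ν h N x| +
        (|isEstimate μ ν h N x - ∫ y, h y ∂ν| + |(∫ y, h y ∂ν) - ∫ y, f y ∂ν|) := by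
    intro x
    calc |isEstimate μ ν f N x - ∫ y, f y ∂ν|
        ≤ |isEstimate μ ν f N x - isEstimate μ ν h N x| + |isEstimate μ ν h N x - ∫ y, f y ∂ν| :=
          abs_sub_le _ _ _
      _ ≤ _ := by gcongr; exact abs_sub_le _ _ _
  have hi1 : Integrable (fun x => |isEstimate μ ν f N x - isEstimate μ ν h N x|) Q :=
    ((hI f hfd).sub (hI h hhd)).abs
  have hi2 : Integrable (fun x => |isEstimate μ ν h N x - ∫ y, h y ∂ν|) Q :=
    ((hI h hhd).sub (integrable_const _)).abs
  have hi23 : Integrable (fun x => |isEstimate μ ν h N x - ∫ y, h y ∂ν| +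
      |(∫ y, h y ∂ν) - ∫ y, f y ∂ν|) Q := hi2.add (integrable_const _)
  have hsum : ∫ x, |isEstimate μ ν f N x - ∫ y, f y ∂ν| ∂Q ≤
      T + (Real.sqrt (C * a / N) * Real.sqrt F + T) := by
    calc ∫ x, |isEstimate μ ν f N x - ∫ y, f y ∂ν| ∂Q
        ≤ ∫ x, |isEstimate μ ν f N x - isEstimate μ ν h N x| +
            (|isEstimate μ ν h N x - ∫ y, h y ∂ν| + |(∫ y, h y ∂ν) - ∫ y, f y ∂ν|) ∂Q :=
          integral_mono_of_nonneg (ae_of_all _ fun _ => abs_nonneg _)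
            (hi1.add hi23) (ae_of_all _ h3)
      _ = ∫ x, |isEstimate μ ν f N x - isEstimate μ ν h N x| ∂Q +
            (∫ x, |isEstimate μ ν h N x - ∫ y, h y ∂ν| ∂Q + |(∫ y, h y ∂ν) - ∫ y, f y ∂ν|) := by
          rw [integral_add hi1 hi23, integral_add hi2 (integrable_const _),
            integral_const, probReal_univ, one_smul]
      _ ≤ T + (Real.sqrt (C * a / N) * Real.sqrt F + T) := by gcongr
  have hre : Real.sqrt F * (Real.sqrt (C * a / N) + 2 * Real.sqrt (ν A).toReal) =
      Real.sqrt (C * a / N) * Real.sqrt F + 2 * (Real.sqrt F * Real.sqrt (ν A).toReal) := by ring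
  rw [hre]
  linarith

end General

end Summit.Ventures.LatticeQCDFlow.Exactness.GeneralNCMC
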